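/-
Copyright: statement-level skeleton of a published paper (lit-balaban cell, Phase-2 proof seat p39 gen 32). No proof claims
beyond what the kernel checks below.
-/
import Literature.MathematicalPhysics.QuantumFieldTheory.Balaban1983to89.B3Eq124IndexFourZero
import Literature.MathematicalPhysics.QuantumFieldTheory.Balaban1983to89.B3Eq124IndexTwoOne

/-!
# Bałaban, *(Higgs)₂,₃ quantum fields in a finite volume. III*, CMP 88 (1983) [Balaban1983Higgs3], p. 417: THE INDEX `(4,1)` OF
# THE VACUUM-ENERGY COUNTERTERM (1.24) — the `e⁴λ` term of `E₁` for the action (1.20) with print's counterterm series inserted,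
# read in the order of the body of record (`∂⁴/∂e⁴` at `e = 0` OF the right derivative `(∂/∂λ)⁺` at `λ = 0⁺`), IN CUMULANT
# FORM with the vector field integrated out; the fourth derivative of a quotient of even curves (Leibniz)

statement-level skeleton of published theorems with citation tags; proofs where landed; nothing here is a claim about the
Yang–Mills mass gap.

[cite: Balaban1983Higgs3, (1.24) p.417 (PDF 7) and the first paragraph of p.418 (PDF 8); (1.19)–(1.22) p.416 (PDF 6); (1.23) p.417;
(1.8), (1.10) p.413 (PDF 3)] [cite: GlimmJaffeQP1987, §8.4–8.5, (9.1.3)].  Unit `lit-balaban-p39-g32` (Phase-2 proof seat p39, gen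
32), free-target protocol G.5-34(d), ZERO head weight: OPTIONAL LOCATED MEMBER of row **B3.Eq1.24** of
`HOME/lit-balaban-r15/ROWS-B3.md` (owner r15; heads `proved`, decls of record not restated); TAKING `HOME/STATUS.md` 2026-08-24
(BRICK 23 of this seat's series) = the `(4,1)` part of the successor option (F) of `HOME/lit-balaban-p39/DESIGN-weight6-next.md` (the
row owner's preference, r15 g20 2026-08-24T18:22:10Z: the open indices `(4,0)`, `(4,1)`, `(6,0)` *"in structural/cumulant form"*;
BRICKS 21/22 did `(4,0)`/`(6,0)`).  IMPORTED BY NAME, nothing of record redeclared: BRICK 16 `B3Eq124IndexTwoOne` §6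
(`iteratedDerivWithin_one_logZct_eventuallyEq`: near `e = 0` the inner right `λ`-derivative of `log Z^{ct}(e,·)` at `0⁺` IS
`−N_U(e)/Z(e) − ½δm²_{(2,1)}e²·N_Q(e)/Z(e)`), BRICK 21 `B3Eq124IndexFourZero` (`WAI`, `P2`, `P4`, `wai_DkM_two`, `wai_DkM_four`,
`integral_DkM_J_zero_eq`, `polyCts` and its lemmas), through it BRICK 20 `B3ChargeInsertionsHigher` §8 (the derivative families of
`N_F(e) = ∫D^M_k…` for every observable `F`), BRICK 14 `B3Eq123IndexTwoOne` (`expGrowth_U`), BRICK 13 (`Z_joint_neg_charge`), BRICK 10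
(`expGrowth_massForm`), BRICK 7 (`J`, `WA`, `integral_J_pos`, `ZA_pos`), `B3WT226Traces.Z_pos`, and Mathlib's Leibniz rule
`iteratedDeriv_mul` / `iteratedDeriv_fun_pow_zero`.  BRICK 13's/21's private parity and family lemmas are re-derived privately.

PDF held: `paper:balaban1983-higgs-2-3-quantum-fields-finite-volume` (journal page = PDF page + 410); pp. 413, 416–418 read for
BRICKS 1/7/12–22 on the ×2 renders `run/shared/lean/pub/pub-balaban/b2b-balaban-ref1/pages/1983-cmp88-higgs23-III/…-p003-x2.png`,
`…-p006-x2.png`, `…-p007-x2.png` (re-read as an image 2026-08-24T21:12Z for BRICK 21), `…-p008-x2.png`; no new quotation is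
introduced here (the sentences served are (1.24) p. 417 and p. 418 *"… restricted by the condition 2 ≤ α + 2β ≤ 6"*, quoted in
BRICKS 13/17/21 — `(4,1)` is the last index of that range not derived from the measure in the tree).

THE MATHEMATICS (ours; frame = Glimm–Jaffe §8.4–8.5).  Write `Z^{ct}(e,λ) = ∫dA dφ J_e(m² + δm²(e,λ))e^{−λΣ_yη^d∣φ(y)∣⁴}` with
`δm²(e,λ) = δm²_{(2,0)}e² + δm²_{(0,1)}λ + δm²_{(2,1)}e²λ + δm²_{(4,0)}e⁴` (BRICK 16's letters `d20, d01, d21, d40`; `δm²_{(0,2)}λ²` does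
not enter one `λ`-derivative at `0` and is omitted, as in BRICK 16).  BRICK 16 §6: on a ball at `e = 0`, `(∂/∂λ)⁺log Z^{ct}(e,λ)∣_{λ=0}
= g(e) := −f_U(e) − ½δm²_{(2,1)}e²f_Q(e)`, `f_F = N_F/Z`, `N_F(e) = ∫dA dφ J_e(M_e)F`, `M_e = m² + δm²_{(2,0)}e² + δm²_{(4,0)}e⁴`, `U =
Σ_yη^d∣φ(y)∣⁴ + ½δm²_{(0,1)}Σ_yη^d∣φ(y)∣²`, `Q = Σ_yη^d∣φ(y)∣²`, `Z = N_1` — an eventual equality at `0`, which is all `iteratedDeriv 4 ·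
0` sees (Mathlib `Filter.EventuallyEq.iteratedDeriv_eq`).  (§1) For `N`, `Z` with derivative families of all orders on an open `S ∋
0` (so both `C^∞` there), `Z > 0` and `Z` EVEN: `f = N/Z` is `C^∞` on `S`, and Leibniz (`N = fZ`, `iteratedDeriv_mul`) at `0` with
`Z′(0) = Z‴(0) = 0` gives **`f″(0)Z(0) = N″(0) − f(0)Z″(0)`, `f⁗(0)Z(0) = N⁗(0) − 6f″(0)Z″(0) − f(0)Z⁗(0)`**
(`iteratedDeriv_quot_of_even_family`); and `(e²h)⁗(0) = 12h″(0)` (`iteratedDeriv_four_sq_mul`).  (§2) BRICK 20 §8 supplies the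
families for `N_U`, `N_Q`, `Z` along `polyCts d20 d40` (BRICK 21) with the observables `U`, `Q`, `1`; `Z` is even (BRICK 13
`Z_joint_neg_charge`); hence **`iteratedDeriv_four_index41_raw`: `∂⁴_e g(0) = −f_U⁗(0) − 6δm²_{(2,1)}f_Q″(0)`** together with `f_U,
f_Q ∈ C⁴` at `0`.  AT `e = 0` everything factorizes (BRICK 21 §2–§3): `N_F⁽ᵏ⁾(0) = ∫D^M_k(0)J_0F = Z_A·∫W₀P_kF` (`k = 0, 2, 4`; `P₀ =
1`, `P₂`, `P₄` at `ct″(0) = 2δm²_{(2,0)}`, `ct⁗(0) = 24δm²_{(4,0)}`; `ct′(0) = ct‴(0) = 0`), `Z_A` cancels in every quotient, and THE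
HEADLINE **`iteratedDeriv_four_index41`**: `∂⁴_e[(∂/∂λ)⁺log Z^{ct}∣_{λ=0}]∣_{e=0} = −[⟨P₄U⟩₀ − 6(⟨P₂U⟩₀ − ⟨U⟩₀⟨P₂⟩₀)⟨P₂⟩₀ −
⟨U⟩₀⟨P₄⟩₀] − 6δm²_{(2,1)}[⟨P₂Q⟩₀ − ⟨Q⟩₀⟨P₂⟩₀]`, `⟨F⟩₀ = ∫W₀F/∫W₀` the free scalar expectation at mass `m²`.

WHICH COEFFICIENT OF (1.24) THIS IS, AND WHAT IS LEFT SYMBOLIC (as for BRICK 21, r15's ask 2026-08-24T21:00:40Z).  ORDER OF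
DIFFERENTIATION: the body-of-record order of `B3Sect1TwoPoint.E1of124R` (typer g30's `B3Eq124OneSidedBridge`) — FIRST the right
`λ`-derivative at `λ = 0⁺` (one-sided: `e^{+λΣ∣φ∣⁴}` is not integrable), at every charge `e` near `0`, THEN `∂⁴/∂e⁴` (two-sided) at
`e = 0`; the mass counterterm `δm²(e,λ)` sits INSIDE the measure throughout (p. 418: only `E` is dropped).  The `(α,β) = (4,1)` term of
`E1of124R` is `(e⁴λ/(4!·1!))` times this derivative.  (The «e first» order `(∂/∂λ)⁺[∂⁴_e log Z^{ct}(·,λ)∣₀](0⁺)` agrees with it by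
BRICK 18's Schwarz-within-the-slab argument — stated there for every `(α,β)` for the polynomial counterterm; not re-derived here.)
WHICH LETTERS OF (1.23) ENTER: `δm²_{(2,0)}` (`ct″(0) = 2δm²_{(2,0)}`, in `P₂`, `P₄`), `δm²_{(4,0)}` (`ct⁗(0) = 24δm²_{(4,0)}`, in `P₄`),
`δm²_{(0,1)}` (inside `U`: the `λ`-vertex of (1.20) is `Σ_xε^d(λ∣φ(x)∣⁴ + ½δm²∣φ(x)∣²)`, whose order-`λ` mass part is
`½δm²_{(0,1)}Q`), `δm²_{(2,1)}` (the coefficient of the last bracket: the order-`e²λ` mass vertex `½δm²_{(2,1)}e²λQ`, of which `∂⁴_e`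
at `0` keeps `12·½δm²_{(2,1)}·f_Q″(0)`); `δm²_{(3,0)} = δm²_{(1,1)} = 0` (odd `α`), `δm²_{(0,2)}` absent from a first `λ`-derivative.
WHAT IS LEFT SYMBOLIC: the seven free scalar Gaussian expectations `⟨P₄U⟩₀`, `⟨P₂U⟩₀`, `⟨U⟩₀`, `⟨P₄⟩₀`, `⟨P₂⟩₀`, `⟨P₂Q⟩₀`, `⟨Q⟩₀` at
mass `m²` (`P₄U` has degree ≤ 12 in `φ`); the vector-field integrals are DONE (BRICK 21's `cv`-coefficients inside `P₂`, `P₄`).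

WHAT THIS FILE PROVES — theorems only (no definition, no named fact, no `sorry`, standard axioms): §1 `iteratedDeriv_quot_of_even_family`,
`iteratedDeriv_four_sq_mul` (+ private parity/family helpers); §2 `wai_DkM_zero`, `iteratedDeriv_four_index41_raw`,
`iteratedDeriv_four_index41`.

HONEST SCOPE.  (a) Cumulant form as the row owner allows: no scalar Wick theorem on the seven expectations, no graph, no estimate
as `ε → 0`, nothing about p. 418's *"the other terms are convergent"*.  (b) The Wick-ordering of the quartic interaction is print's
`:·:` convention handled in BRICKS 12/15/17 on the `λ`-side; here, as in BRICK 16, the `λ`-vertex is the plain `Σ_yη^d∣φ(y)∣⁴` of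
(1.20) plus the `δm²_{(0,1)}` mass part (`U`), exactly BRICK 16's reading — the file inherits BRICK 16's `hU` hypothesis verbatim.
(c) Finite torus, Feynman gauge, any `d`, `N`, mesh, level.  (d) The raw theorem also records `f_U, f_Q ∈ C⁴` at `0` (used by the
headline's Leibniz step); the `C^∞` statement on the ball is inside `iteratedDeriv_quot_of_even_family`.

References: [Balaban1983Higgs3] T. Bałaban, *(Higgs)₂,₃ quantum fields in a finite volume. III. Renormalization*, CMP 88 (1983)
411–445, pp. 413, 416–418; [Balaban1982Higgs1] T. Bałaban, CMP 85 (1982) 603–636, (1.7), (1.11) p. 605; [GlimmJaffeQP1987]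
J. Glimm, A. Jaffe, *Quantum Physics. A Functional Integral Point of View*, 2nd ed. (Springer 1987), §8.4–8.5, §9.1 (9.1.3).
Unit `lit-balaban-p39` gen 32 (literature-prover-lit-balaban-p39-g32-0), HOME `run/shared/lean/pub/lit-balaban/`, 2026-08-24.
-/

noncomputable section

open scoped BigOperators InnerProductSpace Topology

namespace Literature.MathematicalPhysics.QuantumFieldTheory.Balaban1983to89.B3Eq124IndexFourOne

open _root_.MeasureTheory _root_.Filter _root_.Set
open LatticeFieldCalculus B3WT223Instance B3WTPropagator B3WTCovariance B3WickVertexCalculus B3Eq122ChargeWick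
  B3ChargeInsertionsHigher B3ChargeInsertionsHigher.MassCurve B3Eq124IndexFourZero B3Eq124IndexTwoOne MvPolynomial

variable {P : Params} {j N : ℕ} (C : HiggsLattice.ChargeData N) (η w c m2 μ2 : ℝ)

/-! ## §1 The calculus of the outer derivative: `∂⁴_e` at `0` of a quotient `N/Z` of even functions with derivative families
(Leibniz: `N⁗ = f⁗Z + 6f″Z″ + fZ⁗` at `0` for `f = N/Z`), and of `e²·h` (`(e²h)⁗(0) = 12h″(0)`) -/

section Calculus

open scoped ContDiff

omit C η w c m2 μ2 in
/-- the derivative of an even function is odd (Mathlib's total `deriv`). [folklore] -/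
private theorem deriv_neg_of_even'' {f : ℝ → ℝ} (hf : ∀ s, f (-s) = f s) (s : ℝ) : deriv f (-s) = -deriv f s := by
  have h := deriv_comp_neg f s
  have hfe : (fun x => f (-x)) = f := funext hf
  rw [hfe] at h
  linarith

omit C η w c m2 μ2 in
/-- the derivative of an odd function is even. [folklore] -/
private theorem deriv_neg_of_odd'' {g : ℝ → ℝ} (hg : ∀ s, g (-s) = -g s) (s : ℝ) : deriv g (-s) = deriv g s := by
  have h := deriv_comp_neg g s
  have hge : (fun x => g (-x)) = -g := funext hg
  rw [hge, deriv.neg] at h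
  linarith

omit C η w c m2 μ2 in
/-- the even-order derivatives of an even function are even. [folklore] -/
private theorem iteratedDeriv_even_of_even'' {f : ℝ → ℝ} (hf : ∀ s, f (-s) = f s) (k : ℕ) (s : ℝ) :
    iteratedDeriv (2 * k) f (-s) = iteratedDeriv (2 * k) f s := by
  induction k generalizing s with
  | zero => simpa using hf s
  | succ k ih =>
    have h2 : 2 * (k + 1) = 2 * k + 1 + 1 := by ring
    rw [h2, iteratedDeriv_succ, iteratedDeriv_succ]
    exact deriv_neg_of_odd'' (deriv_neg_of_even'' ih) s

omit C η w c m2 μ2 in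
/-- the odd-order derivatives of an even function vanish at `0`. [folklore] -/
private theorem iteratedDeriv_odd_eq_zero_of_even'' {f : ℝ → ℝ} (hf : ∀ s, f (-s) = f s) (k : ℕ) :
    iteratedDeriv (2 * k + 1) f 0 = 0 := by
  rw [iteratedDeriv_succ]
  have h := deriv_neg_of_even'' (iteratedDeriv_even_of_even'' hf k) 0
  rw [neg_zero] at h
  linarith

omit C η w c m2 μ2 in
/-- a derivative family on an open set computes the iterated derivatives there. [folklore] -/
private theorem iteratedDeriv_eq_of_family' {Zk : ℕ → ℝ → ℝ} {S : Set ℝ} (hS : IsOpen S)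
    (hZk : ∀ (k : ℕ), ∀ e ∈ S, HasDerivAt (Zk k) (Zk (k + 1) e) e) (k : ℕ) {e : ℝ} (he : e ∈ S) :
    iteratedDeriv k (Zk 0) e = Zk k e := by
  induction k generalizing e with
  | zero => simp
  | succ k ih =>
    rw [iteratedDeriv_succ]
    have hev : iteratedDeriv k (Zk 0) =ᶠ[𝓝 e] Zk k := Filter.eventually_of_mem (hS.mem_nhds he) fun s hs => ih hs
    rw [hev.deriv_eq]
    exact (hZk k e he).deriv

omit C η w c m2 μ2 in
/-- a derivative family of all orders on an open set makes its first member smooth there. [folklore] -/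
private theorem contDiffOn_of_family' {Zk : ℕ → ℝ → ℝ} {S : Set ℝ} (hS : IsOpen S)
    (hZk : ∀ (k : ℕ), ∀ e ∈ S, HasDerivAt (Zk k) (Zk (k + 1) e) e) (k : ℕ) : ContDiffOn ℝ ∞ (Zk k) S := by
  have hnat : ∀ n : ℕ, ∀ k : ℕ, ContDiffOn ℝ n (Zk k) S := by
    intro n
    induction n with
    | zero =>
      intro k
      exact contDiffOn_zero.2 fun e he => (hZk k e he).continuousAt.continuousWithinAt
    | succ n ih =>
      intro k
      rw [Nat.cast_succ, contDiffOn_succ_iff_deriv_of_isOpen hS]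
      refine ⟨fun e he => (hZk k e he).differentiableAt.differentiableWithinAt,
        fun h => absurd h (WithTop.natCast_ne_top n), ?_⟩
      exact (ih (k + 1)).congr fun e he => (hZk k e he).deriv
  exact contDiffOn_infty.2 fun n => hnat n k

omit C η w c m2 μ2 in
/-- **THE QUOTIENT AT A SYMMETRIC POINT (Leibniz)**: for `N`, `Z` with derivative families of all orders on an open `S ∋ 0`, `Z > 0`
and `Z` EVEN, the quotient `f = N/Z` is smooth on `S` and `f″(0)Z(0) = N″(0) − f(0)Z″(0)`, `f⁗(0)Z(0) = N⁗(0) − 6f″(0)Z″(0) −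
f(0)Z⁗(0)` (the odd derivatives of `Z` vanish at `0`). [cite: GlimmJaffeQP1987, §8.5] -/
theorem iteratedDeriv_quot_of_even_family {N Z : ℝ → ℝ} {S : Set ℝ} (hS : IsOpen S) (h0 : (0 : ℝ) ∈ S)
    {Nk Zk : ℕ → ℝ → ℝ} (hN0 : Nk 0 = N) (hZ0 : Zk 0 = Z)
    (hNk : ∀ (k : ℕ), ∀ e ∈ S, HasDerivAt (Nk k) (Nk (k + 1) e) e)
    (hZk : ∀ (k : ℕ), ∀ e ∈ S, HasDerivAt (Zk k) (Zk (k + 1) e) e)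
    (hpos : ∀ e ∈ S, 0 < Z e) (hZeven : ∀ e, Z (-e) = Z e) :
    ContDiffOn ℝ ∞ (fun e => N e / Z e) S ∧
    iteratedDeriv 2 (fun e => N e / Z e) 0 * Zk 0 0 = Nk 2 0 - (Nk 0 0 / Zk 0 0) * Zk 2 0 ∧
    iteratedDeriv 4 (fun e => N e / Z e) 0 * Zk 0 0 =
      Nk 4 0 - 6 * iteratedDeriv 2 (fun e => N e / Z e) 0 * Zk 2 0 - (Nk 0 0 / Zk 0 0) * Zk 4 0 := by
  subst hN0 hZ0
  have hNs : ContDiffOn ℝ ∞ (Nk 0) S := contDiffOn_of_family' hS hNk 0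
  have hZs : ContDiffOn ℝ ∞ (Zk 0) S := contDiffOn_of_family' hS hZk 0
  have hne : ∀ e ∈ S, Zk 0 e ≠ 0 := fun e he => (hpos e he).ne'
  have hfs : ContDiffOn ℝ ∞ (fun e => Nk 0 e / Zk 0 e) S := hNs.div hZs hne
  have hfA : ContDiffAt ℝ ∞ (fun e => Nk 0 e / Zk 0 e) 0 := hfs.contDiffAt (hS.mem_nhds h0)
  have hZA : ContDiffAt ℝ ∞ (Zk 0) 0 := hZs.contDiffAt (hS.mem_nhds h0)
  have hle : ∀ k : ℕ, (k : ℕ∞ω) ≤ ∞ := fun k => by exact_mod_cast le_top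
  -- `N = f·Z` near `0`, Leibniz
  have hev : Nk 0 =ᶠ[𝓝 0] fun e => (Nk 0 e / Zk 0 e) * Zk 0 e :=
    Filter.eventually_of_mem (hS.mem_nhds h0) fun e he => (div_mul_cancel₀ (Nk 0 e) (hne e he)).symm
  have hL : ∀ k : ℕ, Nk k 0 = ∑ i ∈ Finset.range (k + 1),
      (k.choose i : ℝ) * iteratedDeriv i (fun e => Nk 0 e / Zk 0 e) 0 * iteratedDeriv (k - i) (Zk 0) 0 := by
    intro k
    rw [← iteratedDeriv_eq_of_family' hS hNk k h0, hev.iteratedDeriv_eq k]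
    exact iteratedDeriv_fun_mul (hfA.of_le (hle k)) (hZA.of_le (hle k))
  have hZ1 : iteratedDeriv 1 (Zk 0) 0 = 0 := iteratedDeriv_odd_eq_zero_of_even'' hZeven 0
  have hZ3 : iteratedDeriv 3 (Zk 0) 0 = 0 := iteratedDeriv_odd_eq_zero_of_even'' hZeven 1
  have hZ2 : iteratedDeriv 2 (Zk 0) 0 = Zk 2 0 := iteratedDeriv_eq_of_family' hS hZk 2 h0
  have hZ4 : iteratedDeriv 4 (Zk 0) 0 = Zk 4 0 := iteratedDeriv_eq_of_family' hS hZk 4 h0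
  have e2 := hL 2
  have e4 := hL 4
  simp only [Finset.sum_range_succ, Finset.sum_range_zero, zero_add, Nat.choose, Nat.sub_self] at e2 e4
  norm_num at e2 e4
  have hZ1' : deriv (Zk 0) 0 = 0 := by rw [← iteratedDeriv_one]; exact hZ1
  simp only [hZ1', hZ2, hZ3, hZ4, mul_zero, add_zero] at e2 e4
  refine ⟨hfs, ?_, ?_⟩
  · linarith
  · linarith

omit C η w c m2 μ2 in
/-- **`(e²·h)⁗(0) = 12h″(0)`** for `h` of class `C⁴` at `0` (Leibniz; only the term with both derivatives on `e²` survives).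
[cite: GlimmJaffeQP1987, §8.5] -/
theorem iteratedDeriv_four_sq_mul {h : ℝ → ℝ} (hh : ContDiffAt ℝ 4 h 0) :
    iteratedDeriv 4 (fun e : ℝ => e ^ 2 * h e) 0 = 12 * iteratedDeriv 2 h 0 := by
  have hp : ContDiffAt ℝ 4 (fun e : ℝ => e ^ 2) 0 := contDiffAt_id.pow 2
  rw [iteratedDeriv_fun_mul hp hh]
  simp only [Finset.sum_range_succ, Finset.sum_range_zero, zero_add, iteratedDeriv_fun_pow_zero, Nat.choose]
  norm_num [Nat.factorial]

end Calculus

/-! ## §2 THE INDEX `(4,1)` OF (1.24) IN THE ORDER OF THE BODY OF RECORD (`E1of124R`): `∂⁴/∂e⁴∣₀` OF the right derivative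
`(∂/∂λ)⁺log Z^{ct}(e,λ)∣_{λ=0⁺} = −⟨U + ½δm²_{(2,1)}e²Q⟩_e` (BRICK 16 §6), along the mass curve `m² + δm²_{(2,0)}e² + δm²_{(4,0)}e⁴`,
in cumulant form with the vector field integrated out -/

section IndexFourOne

open scoped ContDiff

omit m2 in
/-- `∫dA W_A·D^M_0 = Z_A·1` (`D^M_0 = 1`). [cite: Balaban1983Higgs3, (1.21) p.416] -/
theorem wai_DkM_zero (hw : 0 < w) (hμ : 0 < μ2) (cts : ℕ → ℝ → ℝ) (φ : Cfg P j N) :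
    WAI η w c μ2 (fun A => DkM C η w c cts 0 0 (toVec A) φ) 1 :=
  (WAI.const η c hw hμ 1).congr (fun A => by simp [DkM]) rfl

/-- **THE INDEX `(4,1)` OF (1.24), RAW FORM.**  For print's counterterm series inserted in (1.20) (`δm² = δm²_{(2,0)}e² +
δm²_{(0,1)}λ + δm²_{(2,1)}e²λ + δm²_{(4,0)}e⁴`; letters `d20, d01, d21, d40`) and the body-of-record order (the right
`λ`-derivative at `0⁺` FIRST, at every charge; then `∂⁴/∂e⁴` at `0`): with `U = Σ_yη^d∣φ(y)∣⁴ + ½δm²_{(0,1)}Q`, `Q = Σ_yη^d∣φ(y)∣²`,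
the curves `N_F(e) = ∫dA dφ e^{−S^ε_{e,M_e}}F`, `M_e = m² + δm²_{(2,0)}e² + δm²_{(4,0)}e⁴`, `Z = N_1`, `f_F = N_F/Z = ⟨F⟩_e`:
**`∂⁴_e[(∂/∂λ)⁺log Z^{ct}(e,λ)∣_{λ=0}]∣_{e=0} = −f_U⁗(0) − 6δm²_{(2,1)}·f_Q″(0)`** — BRICK 16's inner derivative
`−f_U(e) − ½δm²_{(2,1)}e²f_Q(e)` differentiated four times (Leibniz: `(e²f_Q)⁗(0) = 12f_Q″(0)`), the quotient curves being `C^∞`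
near `0` (BRICK 20's derivative families). [cite: Balaban1983Higgs3, (1.20) p.416, (1.23)–(1.24) p.417, p.418] [cite: GlimmJaffeQP1987, §8.5] -/
theorem iteratedDeriv_four_index41_raw (hw : 0 < w) (hm : 0 < m2) (hμ : 0 < μ2) (d20 d01 d21 d40 : ℝ)
    {U : Cfg P j N → ℝ} (hU : ∀ φ, U φ = (∑ y : Site P j, w * ‖φ y‖ ^ 4) + 1 / 2 * d01 * massForm w φ) :
    iteratedDeriv 4 (fun e : ℝ => iteratedDerivWithin 1 (fun lam : ℝ => Real.log (∫ p : JCfg P j N,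
        J C η w c (m2 + (d20 * e ^ 2 + d01 * lam + d21 * (e ^ 2 * lam) + d40 * e ^ 4)) μ2 e p *
          Real.exp (-(lam * ∑ y : Site P j, w * ‖p.2 y‖ ^ 4)))) (Set.Ici 0) 0) 0 =
      -(iteratedDeriv 4 (fun e : ℝ => (∫ p : JCfg P j N, J C η w c (m2 + (d20 * e ^ 2 + d40 * e ^ 4)) μ2 e p * U p.2) /
            ∫ p : JCfg P j N, J C η w c (m2 + (d20 * e ^ 2 + d40 * e ^ 4)) μ2 e p * (1 : ℝ)) 0)
        - 6 * d21 * iteratedDeriv 2 (fun e : ℝ =>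
            (∫ p : JCfg P j N, J C η w c (m2 + (d20 * e ^ 2 + d40 * e ^ 4)) μ2 e p * massForm w p.2) /
              ∫ p : JCfg P j N, J C η w c (m2 + (d20 * e ^ 2 + d40 * e ^ 4)) μ2 e p * (1 : ℝ)) 0 ∧
      ContDiffAt ℝ 4 (fun e : ℝ => (∫ p : JCfg P j N, J C η w c (m2 + (d20 * e ^ 2 + d40 * e ^ 4)) μ2 e p * U p.2) /
            ∫ p : JCfg P j N, J C η w c (m2 + (d20 * e ^ 2 + d40 * e ^ 4)) μ2 e p * (1 : ℝ)) 0 ∧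
      ContDiffAt ℝ 4 (fun e : ℝ => (∫ p : JCfg P j N, J C η w c (m2 + (d20 * e ^ 2 + d40 * e ^ 4)) μ2 e p * massForm w p.2) /
            ∫ p : JCfg P j N, J C η w c (m2 + (d20 * e ^ 2 + d40 * e ^ 4)) μ2 e p * (1 : ℝ)) 0 := by
  rw [(iteratedDerivWithin_one_logZct_eventuallyEq C η w c m2 μ2 hw hm hμ d20 d01 d21 d40 hU).iteratedDeriv_eq 4]
  -- the ball and the derivative families of `N_U`, `N_Q`, `Z` (BRICK 20 §8 along `polyCts d20 d40`)
  obtain ⟨r, hr, hr1, hmass⟩ := exists_ball_polyCts m2 hm d20 d40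
  have hBc : ∀ (i : ℕ), ∀ e ∈ Metric.ball (0 : ℝ) r, |polyCts d20 d40 i e| ≤ 24 * (|d20| + |d40|) := fun i e he =>
    abs_polyCts_le d20 d40 i (by
      have h := Metric.mem_ball.mp he
      rw [Real.dist_eq, sub_zero] at h
      linarith)
  have hS : IsOpen (Metric.ball (0 : ℝ) r) := Metric.isOpen_ball
  have h0S : (0 : ℝ) ∈ Metric.ball (0 : ℝ) r := Metric.mem_ball_self hr
  have hct := hasDerivAt_polyCts d20 d40
  have hUg : ExpGrowth U := B3Eq123IndexTwoOne.expGrowth_U w d01 hU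
  have hQg : ExpGrowth (fun φ : Cfg P j N => massForm w φ) :=
    B3Eq123RenormalizationConditions.expGrowth_massForm (P := P) (j := j) (N := N) w
  have h1g : ExpGrowth (fun _ : Cfg P j N => (1 : ℝ)) := ExpGrowth.const 1
  set NU : ℕ → ℝ → ℝ := fun k e => ∫ p : JCfg P j N,
    DkM C η w c (polyCts d20 d40) k e (toVec p.1) p.2 * J C η w c (m2 + polyCts d20 d40 0 e) μ2 e p * U p.2 with hNU
  set NQ : ℕ → ℝ → ℝ := fun k e => ∫ p : JCfg P j N,
    DkM C η w c (polyCts d20 d40) k e (toVec p.1) p.2 * J C η w c (m2 + polyCts d20 d40 0 e) μ2 e p * massForm w p.2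
    with hNQ
  set Zk : ℕ → ℝ → ℝ := fun k e => ∫ p : JCfg P j N,
    DkM C η w c (polyCts d20 d40) k e (toVec p.1) p.2 * J C η w c (m2 + polyCts d20 d40 0 e) μ2 e p * (1 : ℝ) with hZk_def
  have hNUk : ∀ (k : ℕ), ∀ e ∈ Metric.ball (0 : ℝ) r, HasDerivAt (NU k) (NU (k + 1) e) e := fun k e he =>
    hasDerivAt_integral_DkM_J_mul C η w c m2 μ2 hw hm hμ hct hS hBc hmass hUg k he
  have hNQk : ∀ (k : ℕ), ∀ e ∈ Metric.ball (0 : ℝ) r, HasDerivAt (NQ k) (NQ (k + 1) e) e := fun k e he =>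
    hasDerivAt_integral_DkM_J_mul C η w c m2 μ2 hw hm hμ hct hS hBc hmass hQg k he
  have hZk : ∀ (k : ℕ), ∀ e ∈ Metric.ball (0 : ℝ) r, HasDerivAt (Zk k) (Zk (k + 1) e) e := fun k e he =>
    hasDerivAt_integral_DkM_J_mul C η w c m2 μ2 hw hm hμ hct hS hBc hmass h1g k he
  have hc0 : ∀ e : ℝ, polyCts d20 d40 0 e = d20 * e ^ 2 + d40 * e ^ 4 := fun e => rfl
  have hNU0 : NU 0 = fun e => ∫ p : JCfg P j N, J C η w c (m2 + (d20 * e ^ 2 + d40 * e ^ 4)) μ2 e p * U p.2 := by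
    funext e; exact integral_congr_ae (Filter.Eventually.of_forall fun p => by simp [DkM, hc0])
  have hNQ0 : NQ 0 = fun e => ∫ p : JCfg P j N, J C η w c (m2 + (d20 * e ^ 2 + d40 * e ^ 4)) μ2 e p * massForm w p.2 := by
    funext e; exact integral_congr_ae (Filter.Eventually.of_forall fun p => by simp [DkM, hc0])
  have hZ0 : Zk 0 = fun e => ∫ p : JCfg P j N, J C η w c (m2 + (d20 * e ^ 2 + d40 * e ^ 4)) μ2 e p * (1 : ℝ) := by
    funext e; exact integral_congr_ae (Filter.Eventually.of_forall fun p => by simp [DkM, hc0])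
  have hpos : ∀ e ∈ Metric.ball (0 : ℝ) r, 0 < ∫ p : JCfg P j N, J C η w c (m2 + (d20 * e ^ 2 + d40 * e ^ 4)) μ2 e p * (1 : ℝ) :=
    fun e he => by
      simp only [mul_one]
      have hm' : 0 < m2 + (d20 * e ^ 2 + d40 * e ^ 4) := by have := hmass e he; rw [hc0] at this; linarith
      exact integral_J_pos C η w c _ μ2 hw hm' hμ e
  have heven : ∀ e : ℝ, (∫ p : JCfg P j N, J C η w c (m2 + (d20 * (-e) ^ 2 + d40 * (-e) ^ 4)) μ2 (-e) p * (1 : ℝ)) =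
      ∫ p : JCfg P j N, J C η w c (m2 + (d20 * e ^ 2 + d40 * e ^ 4)) μ2 e p * (1 : ℝ) := fun e =>
    B3Eq124VacuumChargeWick.Z_joint_neg_charge C η w c m2 μ2 (ct := fun e (_ : ℝ) => d20 * e ^ 2 + d40 * e ^ 4)
      (fun e l => by ring) (fun _ _ => (1 : ℝ)) e 0
  obtain ⟨hfU, eU2, eU4⟩ := iteratedDeriv_quot_of_even_family hS h0S hNU0 hZ0 hNUk hZk hpos heven
  obtain ⟨hfQ, eQ2, -⟩ := iteratedDeriv_quot_of_even_family hS h0S hNQ0 hZ0 hNQk hZk hpos heven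
  have hle' : ∀ k : ℕ, (k : ℕ∞ω) ≤ ∞ := fun k => by exact_mod_cast le_top
  have hle := hle' 4
  have hfU4 := (hfU.contDiffAt (hS.mem_nhds h0S)).of_le hle
  have hfQ4 := (hfQ.contDiffAt (hS.mem_nhds h0S)).of_le hle
  refine ⟨?_, hfU4, hfQ4⟩
  -- the outer derivative, by linearity and Leibniz
  have hsq : ContDiffAt ℝ 4 (fun e : ℝ => e ^ 2 *
      ((∫ p : JCfg P j N, J C η w c (m2 + (d20 * e ^ 2 + d40 * e ^ 4)) μ2 e p * massForm w p.2) /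
        ∫ p : JCfg P j N, J C η w c (m2 + (d20 * e ^ 2 + d40 * e ^ 4)) μ2 e p * (1 : ℝ))) 0 :=
    (contDiffAt_id.pow 2).mul hfQ4
  have hfun : (fun e : ℝ => -((∫ p : JCfg P j N, J C η w c (m2 + (d20 * e ^ 2 + d40 * e ^ 4)) μ2 e p * U p.2) /
            ∫ p : JCfg P j N, J C η w c (m2 + (d20 * e ^ 2 + d40 * e ^ 4)) μ2 e p * (1 : ℝ))
        - 1 / 2 * d21 * e ^ 2 *
          ((∫ p : JCfg P j N, J C η w c (m2 + (d20 * e ^ 2 + d40 * e ^ 4)) μ2 e p * massForm w p.2) /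
            ∫ p : JCfg P j N, J C η w c (m2 + (d20 * e ^ 2 + d40 * e ^ 4)) μ2 e p * (1 : ℝ))) =
      fun e : ℝ => -((∫ p : JCfg P j N, J C η w c (m2 + (d20 * e ^ 2 + d40 * e ^ 4)) μ2 e p * U p.2) /
            ∫ p : JCfg P j N, J C η w c (m2 + (d20 * e ^ 2 + d40 * e ^ 4)) μ2 e p * (1 : ℝ))
        - (1 / 2 * d21) * (e ^ 2 *
          ((∫ p : JCfg P j N, J C η w c (m2 + (d20 * e ^ 2 + d40 * e ^ 4)) μ2 e p * massForm w p.2) /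
            ∫ p : JCfg P j N, J C η w c (m2 + (d20 * e ^ 2 + d40 * e ^ 4)) μ2 e p * (1 : ℝ))) := by
    funext e; ring
  rw [hfun, iteratedDeriv_fun_sub hfU4.neg (contDiffAt_const.mul hsq), iteratedDeriv_fun_neg,
    iteratedDeriv_const_mul _ hsq, iteratedDeriv_four_sq_mul hfQ4]
  ring

/-- **THE INDEX `(4,1)` OF (1.24) IN CUMULANT FORM WITH THE VECTOR FIELD INTEGRATED OUT.**  With `⟨F⟩₀ = ∫W₀F/∫W₀` the free
scalar expectation at mass `m²`, `P₂`, `P₄` BRICK 21's polynomials at `ct″(0) = 2δm²_{(2,0)}`, `ct⁗(0) = 24δm²_{(4,0)}`, `U =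
Σ_yη^d∣φ(y)∣⁴ + ½δm²_{(0,1)}Q`, `Q = Σ_yη^d∣φ(y)∣²`:
**`∂⁴_e[(∂/∂λ)⁺log Z^{ct}(e,λ)∣_{λ=0}]∣_{e=0} = −[⟨P₄U⟩₀ − 6(⟨P₂U⟩₀ − ⟨U⟩₀⟨P₂⟩₀)⟨P₂⟩₀ − ⟨U⟩₀⟨P₄⟩₀] −
6δm²_{(2,1)}·[⟨P₂Q⟩₀ − ⟨Q⟩₀⟨P₂⟩₀]`** — the `e⁴λ` term of `E₁` is `(1/4!)` times this; the letters of (1.23) that enter are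
`δm²_{(2,0)}` (in `P₂`, `P₄`), `δm²_{(4,0)}` (in `P₄`), `δm²_{(0,1)}` (in `U`), `δm²_{(2,1)}` (the last bracket); `δm²_{(0,2)}`
does not enter a first `λ`-derivative.  Left symbolic: the seven free scalar expectations `⟨P₄U⟩₀, ⟨P₂U⟩₀, ⟨U⟩₀, ⟨P₄⟩₀, ⟨P₂⟩₀,
⟨P₂Q⟩₀, ⟨Q⟩₀`. [cite: Balaban1983Higgs3, (1.20) p.416, (1.23)–(1.24) p.417, p.418 ("2 ≤ α + 2β ≤ 6")] [cite: GlimmJaffeQP1987, §8.5] -/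
theorem iteratedDeriv_four_index41 (hw : 0 < w) (hm : 0 < m2) (hμ : 0 < μ2) (d20 d01 d21 d40 : ℝ)
    {U : Cfg P j N → ℝ} (hU : ∀ φ, U φ = (∑ y : Site P j, w * ‖φ y‖ ^ 4) + 1 / 2 * d01 * massForm w φ) :
    iteratedDeriv 4 (fun e : ℝ => iteratedDerivWithin 1 (fun lam : ℝ => Real.log (∫ p : JCfg P j N,
        J C η w c (m2 + (d20 * e ^ 2 + d01 * lam + d21 * (e ^ 2 * lam) + d40 * e ^ 4)) μ2 e p *
          Real.exp (-(lam * ∑ y : Site P j, w * ‖p.2 y‖ ^ 4)))) (Set.Ici 0) 0) 0 =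
      -(((∫ φ : Cfg P j N, weight C η w c m2 (0 : VecField P j ℝ) φ * (P4 C η w c μ2 (2 * d20) (24 * d40) φ * U φ)) /
            (∫ φ : Cfg P j N, weight C η w c m2 (0 : VecField P j ℝ) φ))
          - 6 * (((∫ φ : Cfg P j N, weight C η w c m2 (0 : VecField P j ℝ) φ * (P2 C η w c μ2 (2 * d20) φ * U φ)) /
                  (∫ φ : Cfg P j N, weight C η w c m2 (0 : VecField P j ℝ) φ))
                - ((∫ φ : Cfg P j N, weight C η w c m2 (0 : VecField P j ℝ) φ * U φ) /
                    (∫ φ : Cfg P j N, weight C η w c m2 (0 : VecField P j ℝ) φ)) *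
                  ((∫ φ : Cfg P j N, weight C η w c m2 (0 : VecField P j ℝ) φ * P2 C η w c μ2 (2 * d20) φ) /
                    (∫ φ : Cfg P j N, weight C η w c m2 (0 : VecField P j ℝ) φ))) *
            ((∫ φ : Cfg P j N, weight C η w c m2 (0 : VecField P j ℝ) φ * P2 C η w c μ2 (2 * d20) φ) /
              (∫ φ : Cfg P j N, weight C η w c m2 (0 : VecField P j ℝ) φ))
          - ((∫ φ : Cfg P j N, weight C η w c m2 (0 : VecField P j ℝ) φ * U φ) /
              (∫ φ : Cfg P j N, weight C η w c m2 (0 : VecField P j ℝ) φ)) *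
            ((∫ φ : Cfg P j N, weight C η w c m2 (0 : VecField P j ℝ) φ * P4 C η w c μ2 (2 * d20) (24 * d40) φ) /
              (∫ φ : Cfg P j N, weight C η w c m2 (0 : VecField P j ℝ) φ)))
      - 6 * d21 * (((∫ φ : Cfg P j N, weight C η w c m2 (0 : VecField P j ℝ) φ * (P2 C η w c μ2 (2 * d20) φ * massForm w φ)) /
              (∫ φ : Cfg P j N, weight C η w c m2 (0 : VecField P j ℝ) φ))
          - ((∫ φ : Cfg P j N, weight C η w c m2 (0 : VecField P j ℝ) φ * massForm w φ) /
              (∫ φ : Cfg P j N, weight C η w c m2 (0 : VecField P j ℝ) φ)) *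
            ((∫ φ : Cfg P j N, weight C η w c m2 (0 : VecField P j ℝ) φ * P2 C η w c μ2 (2 * d20) φ) /
              (∫ φ : Cfg P j N, weight C η w c m2 (0 : VecField P j ℝ) φ))) := by
  obtain ⟨hraw, -, -⟩ := iteratedDeriv_four_index41_raw C η w c m2 μ2 hw hm hμ d20 d01 d21 d40 hU
  rw [hraw]
  -- the same families once more, now for their values at `0`
  obtain ⟨r, hr, hr1, hmass⟩ := exists_ball_polyCts m2 hm d20 d40
  have hBc : ∀ (i : ℕ), ∀ e ∈ Metric.ball (0 : ℝ) r, |polyCts d20 d40 i e| ≤ 24 * (|d20| + |d40|) := fun i e he =>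
    abs_polyCts_le d20 d40 i (by
      have h := Metric.mem_ball.mp he
      rw [Real.dist_eq, sub_zero] at h
      linarith)
  have hS : IsOpen (Metric.ball (0 : ℝ) r) := Metric.isOpen_ball
  have h0S : (0 : ℝ) ∈ Metric.ball (0 : ℝ) r := Metric.mem_ball_self hr
  have hct := hasDerivAt_polyCts d20 d40
  have hUg : ExpGrowth U := B3Eq123IndexTwoOne.expGrowth_U w d01 hU
  have hQg : ExpGrowth (fun φ : Cfg P j N => massForm w φ) :=
    B3Eq123RenormalizationConditions.expGrowth_massForm (P := P) (j := j) (N := N) w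
  have h1g : ExpGrowth (fun _ : Cfg P j N => (1 : ℝ)) := ExpGrowth.const 1
  set NU : ℕ → ℝ → ℝ := fun k e => ∫ p : JCfg P j N,
    DkM C η w c (polyCts d20 d40) k e (toVec p.1) p.2 * J C η w c (m2 + polyCts d20 d40 0 e) μ2 e p * U p.2 with hNU
  set NQ : ℕ → ℝ → ℝ := fun k e => ∫ p : JCfg P j N,
    DkM C η w c (polyCts d20 d40) k e (toVec p.1) p.2 * J C η w c (m2 + polyCts d20 d40 0 e) μ2 e p * massForm w p.2
    with hNQ
  set Zk : ℕ → ℝ → ℝ := fun k e => ∫ p : JCfg P j N,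
    DkM C η w c (polyCts d20 d40) k e (toVec p.1) p.2 * J C η w c (m2 + polyCts d20 d40 0 e) μ2 e p * (1 : ℝ) with hZk_def
  have hNUk : ∀ (k : ℕ), ∀ e ∈ Metric.ball (0 : ℝ) r, HasDerivAt (NU k) (NU (k + 1) e) e := fun k e he =>
    hasDerivAt_integral_DkM_J_mul C η w c m2 μ2 hw hm hμ hct hS hBc hmass hUg k he
  have hNQk : ∀ (k : ℕ), ∀ e ∈ Metric.ball (0 : ℝ) r, HasDerivAt (NQ k) (NQ (k + 1) e) e := fun k e he =>
    hasDerivAt_integral_DkM_J_mul C η w c m2 μ2 hw hm hμ hct hS hBc hmass hQg k he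
  have hZk : ∀ (k : ℕ), ∀ e ∈ Metric.ball (0 : ℝ) r, HasDerivAt (Zk k) (Zk (k + 1) e) e := fun k e he =>
    hasDerivAt_integral_DkM_J_mul C η w c m2 μ2 hw hm hμ hct hS hBc hmass h1g k he
  have hc0 : ∀ e : ℝ, polyCts d20 d40 0 e = d20 * e ^ 2 + d40 * e ^ 4 := fun e => rfl
  have hNU0 : NU 0 = fun e => ∫ p : JCfg P j N, J C η w c (m2 + (d20 * e ^ 2 + d40 * e ^ 4)) μ2 e p * U p.2 := by
    funext e; exact integral_congr_ae (Filter.Eventually.of_forall fun p => by simp [DkM, hc0])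
  have hNQ0 : NQ 0 = fun e => ∫ p : JCfg P j N, J C η w c (m2 + (d20 * e ^ 2 + d40 * e ^ 4)) μ2 e p * massForm w p.2 := by
    funext e; exact integral_congr_ae (Filter.Eventually.of_forall fun p => by simp [DkM, hc0])
  have hZ0 : Zk 0 = fun e => ∫ p : JCfg P j N, J C η w c (m2 + (d20 * e ^ 2 + d40 * e ^ 4)) μ2 e p * (1 : ℝ) := by
    funext e; exact integral_congr_ae (Filter.Eventually.of_forall fun p => by simp [DkM, hc0])
  have hpos : ∀ e ∈ Metric.ball (0 : ℝ) r, 0 < ∫ p : JCfg P j N, J C η w c (m2 + (d20 * e ^ 2 + d40 * e ^ 4)) μ2 e p * (1 : ℝ) :=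
    fun e he => by
      simp only [mul_one]
      have hm' : 0 < m2 + (d20 * e ^ 2 + d40 * e ^ 4) := by have := hmass e he; rw [hc0] at this; linarith
      exact integral_J_pos C η w c _ μ2 hw hm' hμ e
  have heven : ∀ e : ℝ, (∫ p : JCfg P j N, J C η w c (m2 + (d20 * (-e) ^ 2 + d40 * (-e) ^ 4)) μ2 (-e) p * (1 : ℝ)) =
      ∫ p : JCfg P j N, J C η w c (m2 + (d20 * e ^ 2 + d40 * e ^ 4)) μ2 e p * (1 : ℝ) := fun e =>
    B3Eq124VacuumChargeWick.Z_joint_neg_charge C η w c m2 μ2 (ct := fun e (_ : ℝ) => d20 * e ^ 2 + d40 * e ^ 4)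
      (fun e l => by ring) (fun _ _ => (1 : ℝ)) e 0
  obtain ⟨-, eU2, eU4⟩ := iteratedDeriv_quot_of_even_family hS h0S hNU0 hZ0 hNUk hZk hpos heven
  obtain ⟨-, eQ2, -⟩ := iteratedDeriv_quot_of_even_family hS h0S hNQ0 hZ0 hNQk hZk hpos heven
  -- the values at `0`: odd `ct`-derivatives vanish, `A` integrates out (BRICK 21 §2–§3)
  have h1 : polyCts d20 d40 1 0 = 0 := by show 2 * d20 * (0 : ℝ) + 4 * d40 * (0 : ℝ) ^ 3 = 0; norm_num
  have h3 : polyCts d20 d40 3 0 = 0 := by show 24 * d40 * (0 : ℝ) = 0; norm_num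
  have h00 : m2 + polyCts d20 d40 0 0 = m2 := by rw [hc0]; norm_num
  have e2c : polyCts d20 d40 2 0 = 2 * d20 := by show 2 * d20 + 12 * d40 * (0 : ℝ) ^ 2 = 2 * d20; norm_num
  have e4c : polyCts d20 d40 4 0 = 24 * d40 := rfl
  have hiU : ∀ k, Integrable (fun p : JCfg P j N => DkM C η w c (polyCts d20 d40) k 0 (toVec p.1) p.2 *
      J C η w c m2 μ2 0 p * U p.2) := fun k => by
    have h := integrable_DkM_J_mul C η w c m2 μ2 hw hm hμ hBc hmass hUg k h0S
    rwa [h00] at h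
  have hiQ : ∀ k, Integrable (fun p : JCfg P j N => DkM C η w c (polyCts d20 d40) k 0 (toVec p.1) p.2 *
      J C η w c m2 μ2 0 p * massForm w p.2) := fun k => by
    have h := integrable_DkM_J_mul C η w c m2 μ2 hw hm hμ hBc hmass hQg k h0S
    rwa [h00] at h
  have hi1 : ∀ k, Integrable (fun p : JCfg P j N => DkM C η w c (polyCts d20 d40) k 0 (toVec p.1) p.2 *
      J C η w c m2 μ2 0 p * (fun _ : Cfg P j N => (1 : ℝ)) p.2) := fun k => by
    have h := integrable_DkM_J_mul C η w c m2 μ2 hw hm hμ hBc hmass h1g k h0S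
    rwa [h00] at h
  have vU0 : NU 0 0 = (∫ A : Cfg P j P.d, WA η w c μ2 A) *
      ∫ φ : Cfg P j N, weight C η w c m2 (0 : VecField P j ℝ) φ * ((1 : ℝ) * U φ) := by
    simp only [hNU, h00]; exact integral_DkM_J_zero_eq C η w c m2 μ2 0 (hiU 0) (wai_DkM_zero C η w c μ2 hw hμ _)
  have vU2 : NU 2 0 = (∫ A : Cfg P j P.d, WA η w c μ2 A) *
      ∫ φ : Cfg P j N, weight C η w c m2 (0 : VecField P j ℝ) φ * (P2 C η w c μ2 (2 * d20) φ * U φ) := by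
    simp only [hNU, h00]; rw [← e2c]
    exact integral_DkM_J_zero_eq C η w c m2 μ2 2 (hiU 2) (wai_DkM_two C η w c μ2 hw hμ h1)
  have vU4 : NU 4 0 = (∫ A : Cfg P j P.d, WA η w c μ2 A) *
      ∫ φ : Cfg P j N, weight C η w c m2 (0 : VecField P j ℝ) φ * (P4 C η w c μ2 (2 * d20) (24 * d40) φ * U φ) := by
    simp only [hNU, h00]; rw [← e2c, ← e4c]
    exact integral_DkM_J_zero_eq C η w c m2 μ2 4 (hiU 4) (wai_DkM_four C η w c μ2 hw hμ h1 h3)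
  have vQ0 : NQ 0 0 = (∫ A : Cfg P j P.d, WA η w c μ2 A) *
      ∫ φ : Cfg P j N, weight C η w c m2 (0 : VecField P j ℝ) φ * ((1 : ℝ) * massForm w φ) := by
    simp only [hNQ, h00]; exact integral_DkM_J_zero_eq C η w c m2 μ2 0 (hiQ 0) (wai_DkM_zero C η w c μ2 hw hμ _)
  have vQ2 : NQ 2 0 = (∫ A : Cfg P j P.d, WA η w c μ2 A) *
      ∫ φ : Cfg P j N, weight C η w c m2 (0 : VecField P j ℝ) φ * (P2 C η w c μ2 (2 * d20) φ * massForm w φ) := by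
    simp only [hNQ, h00]; rw [← e2c]
    exact integral_DkM_J_zero_eq C η w c m2 μ2 2 (hiQ 2) (wai_DkM_two C η w c μ2 hw hμ h1)
  have vZ0 : Zk 0 0 = (∫ A : Cfg P j P.d, WA η w c μ2 A) *
      ∫ φ : Cfg P j N, weight C η w c m2 (0 : VecField P j ℝ) φ * ((1 : ℝ) * (fun _ : Cfg P j N => (1 : ℝ)) φ) := by
    simp only [hZk_def, h00]
    exact integral_DkM_J_zero_eq C η w c m2 μ2 0 (F := fun _ => (1 : ℝ)) (hi1 0) (wai_DkM_zero C η w c μ2 hw hμ _)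
  have vZ2 : Zk 2 0 = (∫ A : Cfg P j P.d, WA η w c μ2 A) *
      ∫ φ : Cfg P j N, weight C η w c m2 (0 : VecField P j ℝ) φ * (P2 C η w c μ2 (2 * d20) φ * (fun _ : Cfg P j N => (1 : ℝ)) φ) := by
    simp only [hZk_def, h00]; rw [← e2c]
    exact integral_DkM_J_zero_eq C η w c m2 μ2 2 (F := fun _ => (1 : ℝ)) (hi1 2) (wai_DkM_two C η w c μ2 hw hμ h1)
  have vZ4 : Zk 4 0 = (∫ A : Cfg P j P.d, WA η w c μ2 A) *
      ∫ φ : Cfg P j N, weight C η w c m2 (0 : VecField P j ℝ) φ *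
        (P4 C η w c μ2 (2 * d20) (24 * d40) φ * (fun _ : Cfg P j N => (1 : ℝ)) φ) := by
    simp only [hZk_def, h00]; rw [← e2c, ← e4c]
    exact integral_DkM_J_zero_eq C η w c m2 μ2 4 (F := fun _ => (1 : ℝ)) (hi1 4) (wai_DkM_four C η w c μ2 hw hμ h1 h3)
  simp only [one_mul, mul_one] at vU0 vQ0 vZ0 vZ2 vZ4
  rw [vU0, vU2, vZ0, vZ2] at eU2
  rw [vU0, vU4, vZ0, vZ2, vZ4] at eU4
  rw [vQ0, vQ2, vZ0, vZ2] at eQ2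
  have hZA : (∫ A : Cfg P j P.d, WA η w c μ2 A) ≠ 0 := (ZA_pos η w c μ2 hw hμ).ne'
  have hZ0' : (∫ φ : Cfg P j N, weight C η w c m2 (0 : VecField P j ℝ) φ) ≠ 0 := (B3WT226Traces.Z_pos C η w c m2 hw hm).ne'
  -- solve the two Leibniz relations for `f_U⁗(0)`, `f_U″(0)`, `f_Q″(0)`
  set X4 := iteratedDeriv 4 (fun e : ℝ => (∫ p : JCfg P j N, J C η w c (m2 + (d20 * e ^ 2 + d40 * e ^ 4)) μ2 e p * U p.2) /
      ∫ p : JCfg P j N, J C η w c (m2 + (d20 * e ^ 2 + d40 * e ^ 4)) μ2 e p * (1 : ℝ)) 0 with hX4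
  set X2 := iteratedDeriv 2 (fun e : ℝ => (∫ p : JCfg P j N, J C η w c (m2 + (d20 * e ^ 2 + d40 * e ^ 4)) μ2 e p * U p.2) /
      ∫ p : JCfg P j N, J C η w c (m2 + (d20 * e ^ 2 + d40 * e ^ 4)) μ2 e p * (1 : ℝ)) 0 with hX2
  set Y2 := iteratedDeriv 2 (fun e : ℝ =>
      (∫ p : JCfg P j N, J C η w c (m2 + (d20 * e ^ 2 + d40 * e ^ 4)) μ2 e p * massForm w p.2) /
        ∫ p : JCfg P j N, J C η w c (m2 + (d20 * e ^ 2 + d40 * e ^ 4)) μ2 e p * (1 : ℝ)) 0 with hY2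
  have hW : (∫ A : Cfg P j P.d, WA η w c μ2 A) * (∫ φ : Cfg P j N, weight C η w c m2 (0 : VecField P j ℝ) φ) ≠ 0 :=
    mul_ne_zero hZA hZ0'
  have eX2 : X2 = ((∫ φ : Cfg P j N, weight C η w c m2 (0 : VecField P j ℝ) φ * (P2 C η w c μ2 (2 * d20) φ * U φ)) /
          (∫ φ : Cfg P j N, weight C η w c m2 (0 : VecField P j ℝ) φ))
        - ((∫ φ : Cfg P j N, weight C η w c m2 (0 : VecField P j ℝ) φ * U φ) /
            (∫ φ : Cfg P j N, weight C η w c m2 (0 : VecField P j ℝ) φ)) *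
          ((∫ φ : Cfg P j N, weight C η w c m2 (0 : VecField P j ℝ) φ * P2 C η w c μ2 (2 * d20) φ) /
            (∫ φ : Cfg P j N, weight C η w c m2 (0 : VecField P j ℝ) φ)) := by
    field_simp
    field_simp at eU2
    linear_combination eU2
  have eY2 : Y2 = ((∫ φ : Cfg P j N, weight C η w c m2 (0 : VecField P j ℝ) φ * (P2 C η w c μ2 (2 * d20) φ * massForm w φ)) /
          (∫ φ : Cfg P j N, weight C η w c m2 (0 : VecField P j ℝ) φ))
        - ((∫ φ : Cfg P j N, weight C η w c m2 (0 : VecField P j ℝ) φ * massForm w φ) /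
            (∫ φ : Cfg P j N, weight C η w c m2 (0 : VecField P j ℝ) φ)) *
          ((∫ φ : Cfg P j N, weight C η w c m2 (0 : VecField P j ℝ) φ * P2 C η w c μ2 (2 * d20) φ) /
            (∫ φ : Cfg P j N, weight C η w c m2 (0 : VecField P j ℝ) φ)) := by
    field_simp
    field_simp at eQ2
    linear_combination eQ2
  have eX4 : X4 = ((∫ φ : Cfg P j N, weight C η w c m2 (0 : VecField P j ℝ) φ * (P4 C η w c μ2 (2 * d20) (24 * d40) φ * U φ)) /
          (∫ φ : Cfg P j N, weight C η w c m2 (0 : VecField P j ℝ) φ))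
        - 6 * X2 * ((∫ φ : Cfg P j N, weight C η w c m2 (0 : VecField P j ℝ) φ * P2 C η w c μ2 (2 * d20) φ) /
            (∫ φ : Cfg P j N, weight C η w c m2 (0 : VecField P j ℝ) φ))
        - ((∫ φ : Cfg P j N, weight C η w c m2 (0 : VecField P j ℝ) φ * U φ) /
            (∫ φ : Cfg P j N, weight C η w c m2 (0 : VecField P j ℝ) φ)) *
          ((∫ φ : Cfg P j N, weight C η w c m2 (0 : VecField P j ℝ) φ * P4 C η w c μ2 (2 * d20) (24 * d40) φ) /
            (∫ φ : Cfg P j N, weight C η w c m2 (0 : VecField P j ℝ) φ)) := by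
    field_simp
    field_simp at eU4
    linear_combination eU4
  rw [eX4, eX2, eY2]

end IndexFourOne


end Literature.MathematicalPhysics.QuantumFieldTheory.Balaban1983to89.B3Eq124IndexFourOne

end
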